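import Summits.QuantumFields.YangMills.Theorems.FluctuationComparisonRegPrIntLOrganTangentCovSandwichSq
import Summits.QuantumFields.YangMills.Theorems.FluctuationComparisonRegPrIntLRunpairOrganFibreLawDefs
import HarnessLib

/-!
# Crux `FluctuationComparisonRegPrIntL` (stmt-QuantumFields-20520, rung R3), PATH-B organ, H-currency cone — (L46′) «KER′ OF THE (I-law-X)sq BLOCK BY THE REAL ROAD»: the
# score-covariance kernel `kX` FROM a second-cumulant kernel of the fibre law at the PATH law points × the observable's first-order transport profile × a SCORE PROFILE
# (px5 g22 §81 (R-real) ∕ 13:32Z verdict; ✓`…OrganTangentCovSandwichSq` (JV2)'s algebra with `K(·,B′) ↦ Q₁(·;B′)`)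

Cell `ym3-torus` (YM ladder rung R3 = continuum `SU(2)` Yang–Mills on the three-torus — a RUNG: NOT d = 4, NOT infinite volume, NOT a mass gap, NOT Clay).
Width seat `ym-ust-20520-w5` (gen 25), `--kind proof --supports stmt-QuantumFields-20520 --as helper`, count-neutral, DEFINITION-FREE, default heartbeats,
no registry ∕ binder ∕ `Lines/` edit.  Over ✓`…OrganTangentPullbackRowMass` (`sum_sandwich_eq`), ✓`…OrganTangentCovSandwich` (`sandwich_abs_sizes_eq`), ✓`…RunpairOrganFibreLawDefs` (`wNum`).

WHY.  The KER′ half of the (I-law-X)sq block of row-sq v0.3 (✓`…OrganTangentLawClausesOfILawAE` `hIlawX`) reads, at a.e. `s ∈ [0,1]` along a near relational path `X`,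
`|Cov_{ŵ_t(X s)}(ΔF, sc_s)| ≤ kX B B′·(‖m‖∕θc)·(‖m′‖∕θc)`, `ΔF = F_{V₁} − F_{U₁}`, `sc_s = deriv_s wNum ∕ wNum` the score of the moving weight (absolute cut × interpolated density ×
Jacobian).  Print never differentiates the fluctuation integral in the background ([Balaban1985UV3] p.263, [Balaban1987RG1] (2.13): analyticity inherited termwise) and the
ABSOLUTE cut has no holomorphic extension, so the honest road on this organ is REAL (px5 §81): a SECOND-CUMULANT KERNEL of the tilted fibre law between two PROFILED observables —
the observable's profile `(‖m‖∕θc)·K(·,B)` ([Balaban1985Variational] Thm 1 (9)–(10)) and the SCORE's profile `(‖m′‖∕θc)·Q₁(·;B′)` (smooth part: background derivatives of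
`Δ_k`, `V_n`, the Jacobian — [5] (3.155)–(3.156), [7] (174)–(181), [B12] p.267; cut part: ramp slopes × per-level displacement) — SOURCES of the shapes only.

WHAT.  §0 [folklore] `rowMass_sandwich_le₂` (✓RM-PB's weighted `ℓ¹` submultiplicativity with TWO profile families: column mass of the left family × kernel row mass × row mass of the
right family), `sub_mul_eq_integral_centred` (`∫PQL − (∫PL)(∫QL) = ∫(P−cP)(Q−cQ)L` under `∫L = 1`).  §1 ★★`kerXClause_of_covKernel_profiles` — ABSTRACT DOOR (`Fobs`, `Law`, a score
family `Sc : ℝ → (ℝ → G_j) → ℝ → Z → ℝ` in `(t, path, s)`, a profile predicate `Prof` INDEXED BY THE LAW POINT): from (G₂^{prof}) the covariance kernel `𝒢` AT THE PATH LAW POINTS `X s`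
for observables profiled there, (K1-path) the transported-difference profile, (SC-PROF-X) the score profile, the law facts at `X s` read `∀ᵐ s` (normalisation + four
integrabilities), and masses (`K` column, `Q₁` row + the transposed pair for the column budget, `𝒢` row∕column, multiplicative triangle `htri`) ⟹ `∃ kX ≥ 0` with BOTH κ-masses
`≤ Ncol·NG·Nrow` and the KER′ SHAPE `∀ᵐ s ∈ Icc 0 1, |∫ ΔF·Sc·Law − (∫ ΔF·Law)(∫ Sc·Law)| ≤ kX B B′·(‖m‖∕θc)·(‖m′‖∕θc)`, `kX B B′ := Σ_{a,c} K a B·𝒢 a c·Q₁ c B′`.  §2 ★★`kerX_organ` —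
the ORGAN DOCK: `Fobs := h_Ts∘Φ`, `Law t Xw z := wNum_t Xw z ∕ ∫ wNum_t Xw`, `Sc t X s z := deriv (σ ↦ wNum_t (X σ) z) s ∕ wNum_t (X s) z`: the KER′ conjunct text of `hIlawX` VERBATIM.

HONEST FRAMING: a door between HYPOTHESIS letters; (G₂^{prof}), (K1-path), (SC-PROF-X) are exactly as OPEN as KER′ (bottom: §76 G2-b, volume-free control of the tilted `m`-step fibre
law); nothing of Bałaban's analysis is asserted or proved; REG′ is ✓p823910's business, not touched; (I-curv), (I-cov), `OrganDischargeInputsHJ(sq)` ∕ `SpreadFibreLawH(J)(sq)`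
UNDISCHARGED; the five registered stubs of `Lines/semiclassical_s2beta.lean`, crux 20520 and `YM3TorusSU2` are NOT proved; registry untouched; rung R3 = SU(2) YM₃ on T³ — NOT d = 4, NOT
infinite volume, NOT a mass gap, NOT Clay; the Yang–Mills mass gap is NOT proved.  [folklore]
-/

set_option autoImplicit false

noncomputable section

namespace Summit.QuantumFields.YangMills.Theorems.OrganTangentILawKerXOfScoreProfile

open MeasureTheory
open scoped BigOperators
open Literature.MathematicalPhysics.QuantumFieldTheory.Balaban1983to89 T3ContinuumYM3Torus T3NestedUnitLaws
  T3UnitLawDensityEML T4Continuum BalabanUVClass T3UnitScaleTilt T3LevelShift T3TiltDescent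
open T4CubeChartExp (expPt)
open Summit.QuantumFields.YangMills.Theorems.OrganTangentPullbackRowMass (sum_sandwich_eq)
open Summit.QuantumFields.YangMills.Theorems.FluctuationComparisonRegPrIntLRunpairOrganFibreLaw (wNum)

/-! ## §0 Folklore: two-family sandwich mass; un-centred vs centred covariance -/

section Folklore

variable {ι ιc : Type*} [Fintype ι] [Fintype ιc]

/-- ★ **ROW MASS OF A TWO-FAMILY SANDWICH**: under `ωc B B′ ≤ ωX a B·ωf a c·ωX c B′`, a column mass `Ncol` of the LEFT family `Xl`, a row mass `Nrow` of the RIGHT family `Xr`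
(both w.r.t. `ωX`) and a row mass `w` of `k` (w.r.t. `ωf`) give `Σ_{B′} (Σ_{a c} Xl a B·k a c·Xr c B′)·ωc B B′ ≤ Ncol·w·Nrow`. [folklore] -/
theorem rowMass_sandwich_le₂ (k : ι → ι → ℝ) (Xl Xr : ι → ιc → ℝ) (ωf : ι → ι → ℝ) (ωc : ιc → ιc → ℝ) (ωX : ι → ιc → ℝ)
    (hk : ∀ a c, 0 ≤ k a c) (hXl : ∀ a B, 0 ≤ Xl a B) (hXr : ∀ a B, 0 ≤ Xr a B) (hωf : ∀ a c, 0 ≤ ωf a c) (hωX : ∀ a B, 0 ≤ ωX a B)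
    (htri : ∀ (B B' : ιc) (a c : ι), ωc B B' ≤ ωX a B * ωf a c * ωX c B')
    {Ncol Nrow w : ℝ} (hw : 0 ≤ w) (hNrow : 0 ≤ Nrow)
    (hcol : ∀ B, ∑ a, Xl a B * ωX a B ≤ Ncol) (hrow : ∀ c, ∑ B', Xr c B' * ωX c B' ≤ Nrow)
    (hkrow : ∀ a, ∑ c, k a c * ωf a c ≤ w) (B : ιc) :
    ∑ B', (∑ a, ∑ c, Xl a B * k a c * Xr c B') * ωc B B' ≤ Ncol * w * Nrow := by
  have step1 : ∑ B', (∑ a, ∑ c, Xl a B * k a c * Xr c B') * ωc B B'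
      ≤ ∑ B', ∑ a, ∑ c, (Xl a B * ωX a B) * (k a c * ωf a c) * (Xr c B' * ωX c B') := by
    refine Finset.sum_le_sum fun B' _ => ?_
    rw [Finset.sum_mul]
    refine Finset.sum_le_sum fun a _ => ?_
    rw [Finset.sum_mul]
    refine Finset.sum_le_sum fun c _ => ?_
    calc Xl a B * k a c * Xr c B' * ωc B B'
        ≤ Xl a B * k a c * Xr c B' * (ωX a B * ωf a c * ωX c B') :=
          mul_le_mul_of_nonneg_left (htri B B' a c) (mul_nonneg (mul_nonneg (hXl a B) (hk a c)) (hXr c B'))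
      _ = (Xl a B * ωX a B) * (k a c * ωf a c) * (Xr c B' * ωX c B') := by ring
  rw [sum_sandwich_eq (fun a => Xl a B * ωX a B) (fun a c => k a c * ωf a c) (fun c B' => Xr c B' * ωX c B')] at step1
  refine step1.trans ?_
  have step2 : ∀ a, (Xl a B * ωX a B) * ∑ c, (k a c * ωf a c) * ∑ B', Xr c B' * ωX c B' ≤ (Xl a B * ωX a B) * (w * Nrow) := by
    intro a
    refine mul_le_mul_of_nonneg_left ?_ (mul_nonneg (hXl a B) (hωX a B))
    calc ∑ c, (k a c * ωf a c) * ∑ B', Xr c B' * ωX c B'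
        ≤ ∑ c, (k a c * ωf a c) * Nrow :=
          Finset.sum_le_sum fun c _ => mul_le_mul_of_nonneg_left (hrow c) (mul_nonneg (hk a c) (hωf a c))
      _ = (∑ c, k a c * ωf a c) * Nrow := by rw [Finset.sum_mul]
      _ ≤ w * Nrow := mul_le_mul_of_nonneg_right (hkrow a) hNrow
  calc ∑ a, (Xl a B * ωX a B) * ∑ c, (k a c * ωf a c) * ∑ B', Xr c B' * ωX c B'
      ≤ ∑ a, (Xl a B * ωX a B) * (w * Nrow) := Finset.sum_le_sum fun a _ => step2 a
    _ = (∑ a, Xl a B * ωX a B) * (w * Nrow) := by rw [Finset.sum_mul]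
    _ ≤ Ncol * (w * Nrow) := mul_le_mul_of_nonneg_right (hcol B) (mul_nonneg hw hNrow)
    _ = Ncol * w * Nrow := by ring

variable {Z : Type*} [MeasurableSpace Z]

/-- Un-centred vs centred covariance under a normalised weight: `∫ P·Q·L − (∫ P·L)(∫ Q·L) = ∫ (P − cP)(Q − cQ)·L` with `cP = ∫ P·L`, `cQ = ∫ Q·L`, `∫ L = 1`. [folklore] -/
theorem sub_mul_eq_integral_centred (τ : Measure Z) (P Q L : Z → ℝ)
    (hL : Integrable L τ) (hn : ∫ z, L z ∂τ = 1) (hP : Integrable (fun z => P z * L z) τ) (hQ : Integrable (fun z => Q z * L z) τ)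
    (hPQ : Integrable (fun z => P z * Q z * L z) τ) :
    (∫ z, P z * Q z * L z ∂τ) - (∫ z, P z * L z ∂τ) * (∫ z, Q z * L z ∂τ)
      = ∫ z, (P z - ∫ z', P z' * L z' ∂τ) * (Q z - ∫ z', Q z' * L z' ∂τ) * L z ∂τ := by
  set cP : ℝ := ∫ z', P z' * L z' ∂τ with hcP
  set cQ : ℝ := ∫ z', Q z' * L z' ∂τ with hcQ
  have e : (∫ z, (P z - cP) * (Q z - cQ) * L z ∂τ)
      = ∫ z, ((P z * Q z * L z - cQ * (P z * L z)) - cP * (Q z * L z)) + (cP * cQ) * L z ∂τ := by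
    congr 1; funext z; ring
  have i1 : Integrable (fun z => P z * Q z * L z - cQ * (P z * L z)) τ := hPQ.sub (hP.const_mul cQ)
  have i2 : Integrable (fun z => (P z * Q z * L z - cQ * (P z * L z)) - cP * (Q z * L z)) τ := i1.sub (hQ.const_mul cP)
  rw [e, integral_add i2 (hL.const_mul _), integral_sub i1 (hQ.const_mul cP), integral_sub hPQ (hP.const_mul cQ),
    integral_const_mul, integral_const_mul, integral_const_mul, hn]
  ring

omit [Fintype ιc] in
/-- Two-family form of ✓`sandwich_abs_sizes_eq`: `Σ_{a,c} |s·K a B|·𝒢 a c·|s′·Q c B′| = (Σ_{a,c} K a B·𝒢 a c·Q c B′)·s·s′`. [folklore] -/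
theorem sandwich_abs_sizes_eq₂ (K Q : ι → ιc → ℝ) (𝒢 : ι → ι → ℝ) (hK : ∀ a B, 0 ≤ K a B) (hQ : ∀ a B, 0 ≤ Q a B)
    (B B' : ιc) {s s' : ℝ} (hs : 0 ≤ s) (hs' : 0 ≤ s') :
    ∑ a, ∑ c, |s * K a B| * 𝒢 a c * |s' * Q c B'| = (∑ a, ∑ c, K a B * 𝒢 a c * Q c B') * s * s' := by
  rw [Finset.sum_mul, Finset.sum_mul]
  refine Finset.sum_congr rfl fun a _ => ?_
  rw [Finset.sum_mul, Finset.sum_mul]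
  refine Finset.sum_congr rfl fun c _ => ?_
  rw [abs_of_nonneg (mul_nonneg hs (hK a B)), abs_of_nonneg (mul_nonneg hs' (hQ c B'))]
  ring

end Folklore

/-! ## §1 The abstract door: KER′(X) shape from the covariance kernel at path law points × observable profile × score profile -/

section Abstract

variable {P : Params} {j : ℕ} {ι : Type*} [Fintype ι] {Z : Type*} [MeasurableSpace Z]

/-- ★★ **KER′ OF THE (I-law-X)sq BLOCK ⟸ (G₂^{prof}) × (K1-path) × (SC-PROF-X)** — abstract currency of ✓`…OrganTangentCovSandwichSq` with a score family `Sc`; see the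
module docstring. [folklore] -/
theorem kerXClause_of_covKernel_profiles (τ : Measure Z) (Fobs : GaugeField P j ↥(Matrix.specialUnitaryGroup (Fin 2) ℂ) → Z → ℝ)
    (Law : ℝ → GaugeField P j ↥(Matrix.specialUnitaryGroup (Fin 2) ℂ) → Z → ℝ)
    (Sc : ℝ → (ℝ → GaugeField P j ↥(Matrix.specialUnitaryGroup (Fin 2) ℂ)) → ℝ → Z → ℝ)
    (θc rc κ M : ℝ) (hθc : 0 < θc)
    (Prof : GaugeField P j ↥(Matrix.specialUnitaryGroup (Fin 2) ℂ) → (Z → ℝ) → (ι → ℝ) → Prop)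
    -- (G₂^{prof}) the covariance kernel at the PATH law points, observables profiled there, t-uniform
    (𝒢 : ι → ι → ℝ) (ωf : ι → ι → ℝ) (NG : ℝ) (hG0 : ∀ a c, 0 ≤ 𝒢 a c) (hωf : ∀ a c, 0 ≤ ωf a c) (hNG : 0 ≤ NG)
    (hGrow : ∀ a, ∑ c, 𝒢 a c * ωf a c ≤ NG) (hGcol : ∀ c, ∑ a, 𝒢 a c * ωf a c ≤ NG) (hωfsymm : ∀ a c, ωf a c = ωf c a)
    (hCov : ∀ t : ℝ, 0 ≤ t → t ≤ 1 → ∀ (B B' : PBond P j) (m m' : Fin 3 → ℝ) (U₁ V₁ W₂ : GaugeField P j ↥(Matrix.specialUnitaryGroup (Fin 2) ℂ)),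
      ‖m‖ ≤ rc * θc → ‖m'‖ ≤ rc * θc → PlaqSmall θc U₁ → PlaqSmall θc V₁ → PlaqSmall θc W₂ →
      (∀ e, e ≠ B → V₁ e = U₁ e) → V₁ B = U₁ B * expPt m → (∀ e, e ≠ B' → W₂ e = V₁ e) → W₂ B' = V₁ B' * expPt m' →
      ∀ (X : ℝ → GaugeField P j ↥(Matrix.specialUnitaryGroup (Fin 2) ℂ)), (∀ s e, e ≠ B' → X s e = V₁ e) → (∀ s, X s B' = V₁ B' * expPt (s • m')) →
      ∀ s ∈ Set.Icc (0:ℝ) 1, ∀ (Pf Qf : Z → ℝ) (p q : ι → ℝ), Prof (X s) Pf p → Prof (X s) Qf q → ∀ (cP cQ : ℝ),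
        cP = ∫ z, Pf z * Law t (X s) z ∂τ → cQ = ∫ z, Qf z * Law t (X s) z ∂τ →
          Integrable (fun z => (Pf z - cP) * (Qf z - cQ) * Law t (X s) z) τ ∧
            |∫ z, (Pf z - cP) * (Qf z - cQ) * Law t (X s) z ∂τ| ≤ ∑ a, ∑ c, |p a| * 𝒢 a c * |q c|)
    -- (K1-path) ∕ (SC-PROF-X): profiles of the transported difference and of the score at the path law points
    (K Q₁ : ι → PBond P j → ℝ) (ωX : ι → PBond P j → ℝ) (Ncol Nrow : ℝ) (hK0 : ∀ a B, 0 ≤ K a B) (hQ0 : ∀ a B, 0 ≤ Q₁ a B) (hωX : ∀ a B, 0 ≤ ωX a B)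
    (hNcol : 0 ≤ Ncol) (hNrow : 0 ≤ Nrow)
    (hKcol : ∀ B, ∑ a, K a B * ωX a B ≤ Ncol) (hKrow : ∀ c, ∑ B', K c B' * ωX c B' ≤ Ncol)
    (hQrow : ∀ c, ∑ B', Q₁ c B' * ωX c B' ≤ Nrow) (hQcol : ∀ B, ∑ a, Q₁ a B * ωX a B ≤ Nrow)
    (htri : ∀ (B B' : PBond P j) (a c : ι), Real.exp (κ * (B.src.tdist B'.src : ℝ)) ≤ ωX a B * ωf a c * ωX c B')
    (htdsymm : ∀ B B' : PBond P j, (B.src.tdist B'.src : ℝ) = (B'.src.tdist B.src : ℝ))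
    (hProfF : ∀ t : ℝ, 0 ≤ t → t ≤ 1 → ∀ (B B' : PBond P j) (m m' : Fin 3 → ℝ) (U₁ V₁ W₂ : GaugeField P j ↥(Matrix.specialUnitaryGroup (Fin 2) ℂ)),
      ‖m‖ ≤ rc * θc → ‖m'‖ ≤ rc * θc → PlaqSmall θc U₁ → PlaqSmall θc V₁ → PlaqSmall θc W₂ →
      (∀ e, e ≠ B → V₁ e = U₁ e) → V₁ B = U₁ B * expPt m → (∀ e, e ≠ B' → W₂ e = V₁ e) → W₂ B' = V₁ B' * expPt m' →
      ∀ (X : ℝ → GaugeField P j ↥(Matrix.specialUnitaryGroup (Fin 2) ℂ)), (∀ s e, e ≠ B' → X s e = V₁ e) → (∀ s, X s B' = V₁ B' * expPt (s • m')) →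
      ∀ s ∈ Set.Icc (0:ℝ) 1,
        Prof (X s) (fun z => Fobs V₁ z - Fobs U₁ z) (fun a => ‖m‖ / θc * K a B) ∧ Prof (X s) (Sc t X s) (fun a => ‖m'‖ / θc * Q₁ a B'))
    -- the law facts at the path law points, a.e. in the path parameter
    (hlaw : ∀ t : ℝ, 0 ≤ t → t ≤ 1 → ∀ (B B' : PBond P j) (m m' : Fin 3 → ℝ) (U₁ V₁ W₂ : GaugeField P j ↥(Matrix.specialUnitaryGroup (Fin 2) ℂ)),
      ‖m‖ ≤ rc * θc → ‖m'‖ ≤ rc * θc → PlaqSmall θc U₁ → PlaqSmall θc V₁ → PlaqSmall θc W₂ →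
      (∀ e, e ≠ B → V₁ e = U₁ e) → V₁ B = U₁ B * expPt m → (∀ e, e ≠ B' → W₂ e = V₁ e) → W₂ B' = V₁ B' * expPt m' →
      ∀ (X : ℝ → GaugeField P j ↥(Matrix.specialUnitaryGroup (Fin 2) ℂ)), (∀ s e, e ≠ B' → X s e = V₁ e) → (∀ s, X s B' = V₁ B' * expPt (s • m')) →
      ∀ᵐ s ∂(volume : Measure ℝ), s ∈ Set.Icc (0:ℝ) 1 →
        Integrable (fun z => Law t (X s) z) τ ∧ ∫ z, Law t (X s) z ∂τ = 1 ∧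
        Integrable (fun z => (Fobs V₁ z - Fobs U₁ z) * Law t (X s) z) τ ∧ Integrable (fun z => Sc t X s z * Law t (X s) z) τ ∧
        Integrable (fun z => (Fobs V₁ z - Fobs U₁ z) * Sc t X s z * Law t (X s) z) τ)
    (hM : Ncol * NG * Nrow ≤ M) :
    ∃ kX : PBond P j → PBond P j → ℝ, (∀ B B', 0 ≤ kX B B') ∧
      (∀ B, ∑ B', kX B B' * Real.exp (κ * (B.src.tdist B'.src : ℝ)) ≤ M) ∧
      (∀ B', ∑ B, kX B B' * Real.exp (κ * (B.src.tdist B'.src : ℝ)) ≤ M) ∧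
      ∀ t : ℝ, 0 ≤ t → t ≤ 1 → ∀ (B B' : PBond P j) (m m' : Fin 3 → ℝ) (U₁ V₁ W₂ : GaugeField P j ↥(Matrix.specialUnitaryGroup (Fin 2) ℂ)),
        ‖m‖ ≤ rc * θc → ‖m'‖ ≤ rc * θc → PlaqSmall θc U₁ → PlaqSmall θc V₁ → PlaqSmall θc W₂ →
        (∀ e, e ≠ B → V₁ e = U₁ e) → V₁ B = U₁ B * expPt m → (∀ e, e ≠ B' → W₂ e = V₁ e) → W₂ B' = V₁ B' * expPt m' →
        ∀ (X : ℝ → GaugeField P j ↥(Matrix.specialUnitaryGroup (Fin 2) ℂ)), (∀ s e, e ≠ B' → X s e = V₁ e) → (∀ s, X s B' = V₁ B' * expPt (s • m')) →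
        ∀ᵐ s ∂(volume : Measure ℝ), s ∈ Set.Icc (0:ℝ) 1 →
          |(∫ z, (Fobs V₁ z - Fobs U₁ z) * Sc t X s z * Law t (X s) z ∂τ)
              - (∫ z, (Fobs V₁ z - Fobs U₁ z) * Law t (X s) z ∂τ) * (∫ z, Sc t X s z * Law t (X s) z ∂τ)|
            ≤ kX B B' * (‖m‖ / θc) * (‖m'‖ / θc) := by
  refine ⟨fun B B' => ∑ a, ∑ c, K a B * 𝒢 a c * Q₁ c B', fun B B' => ?_, fun B => ?_, fun B' => ?_, ?_⟩
  · exact Finset.sum_nonneg fun a _ => Finset.sum_nonneg fun c _ => mul_nonneg (mul_nonneg (hK0 a B) (hG0 a c)) (hQ0 c B')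
  · exact (rowMass_sandwich_le₂ 𝒢 K Q₁ ωf (fun B B' => Real.exp (κ * (B.src.tdist B'.src : ℝ))) ωX hG0 hK0 hQ0 hωf hωX htri hNG hNrow
      hKcol hQrow hGrow B).trans hM
  · -- column mass: transpose the sandwich
    have e : ∀ B, (∑ a, ∑ c, K a B * 𝒢 a c * Q₁ c B') = ∑ c, ∑ a, Q₁ c B' * 𝒢 a c * K a B := by
      intro B; rw [Finset.sum_comm]; exact Finset.sum_congr rfl fun c _ => Finset.sum_congr rfl fun a _ => by ring
    have h := rowMass_sandwich_le₂ (fun c a => 𝒢 a c) Q₁ K (fun c a => ωf a c) (fun B'' B => Real.exp (κ * (B.src.tdist B''.src : ℝ))) ωX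
      (fun c a => hG0 a c) hQ0 hK0 (fun c a => hωf a c) hωX
      (fun B'' B c a => by rw [htdsymm]; calc Real.exp (κ * (B''.src.tdist B.src : ℝ)) ≤ ωX c B'' * ωf c a * ωX a B := htri B'' B c a
        _ = ωX c B'' * ωf a c * ωX a B := by rw [hωfsymm])
      hNG hNcol hQcol hKrow (fun c => by simpa using hGcol c) B'
    calc ∑ B, (∑ a, ∑ c, K a B * 𝒢 a c * Q₁ c B') * Real.exp (κ * (B.src.tdist B'.src : ℝ))
        = ∑ B, (∑ c, ∑ a, Q₁ c B' * 𝒢 a c * K a B) * Real.exp (κ * (B.src.tdist B'.src : ℝ)) := Finset.sum_congr rfl fun B _ => by rw [e]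
      _ ≤ Nrow * NG * Ncol := h
      _ = Ncol * NG * Nrow := by ring
      _ ≤ M := hM
  · intro t ht0 ht1 B B' m m' U₁ V₁ W₂ hm hm' hU hV hW hVU hVB hWU hWB X hoff hon
    filter_upwards [hlaw t ht0 ht1 B B' m m' U₁ V₁ W₂ hm hm' hU hV hW hVU hVB hWU hWB X hoff hon] with s hs hsI
    obtain ⟨hLi, hLn, hFi, hSi, hFSi⟩ := hs hsI
    obtain ⟨hp, hq⟩ := hProfF t ht0 ht1 B B' m m' U₁ V₁ W₂ hm hm' hU hV hW hVU hVB hWU hWB X hoff hon s hsI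
    obtain ⟨-, hbd⟩ := hCov t ht0 ht1 B B' m m' U₁ V₁ W₂ hm hm' hU hV hW hVU hVB hWU hWB X hoff hon s hsI _ _ _ _ hp hq _ _ rfl rfl
    rw [sub_mul_eq_integral_centred τ _ _ _ hLi hLn hFi hSi hFSi]
    refine hbd.trans (le_of_eq ?_)
    exact sandwich_abs_sizes_eq₂ K Q₁ 𝒢 hK0 hQ0 B B' (div_nonneg (norm_nonneg _) hθc.le) (div_nonneg (norm_nonneg _) hθc.le)

end Abstract

/-! ## §2 The organ dock: ✓p821651's `hIlawX` KER′ conjunct text -/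

section Organ

variable {ι : Type*} [Fintype ι]

/-- ★★ **THE ORGAN READING OF §1** — `Fobs := h_Ts∘Φ`, `Law t Xw z := wNum_t Xw z ∕ ∫ wNum_t Xw`, `Sc t X s z := deriv (σ ↦ wNum_t (X σ) z) s ∕ wNum_t (X s) z`,
`θc := θ_j∕4`: the KER′ conjunct of the (I-law-X)sq block VERBATIM (to be paired with ✓p823910's REG′). [folklore] -/
theorem kerX_organ (F : T3Family) (γ b₀ p₀ : ℝ) (j Ts : ℕ)
    (ρ ρ' : (i : ℕ) → GaugeField (F.P i) 0 ↥(Matrix.specialUnitaryGroup (Fin 2) ℂ) → ℝ) {Z : Type} [MeasurableSpace Z] (τ : Measure Z)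
    (Φ : GaugeField (F.P j) 0 ↥(Matrix.specialUnitaryGroup (Fin 2) ℂ) × Z → GaugeField (F.P Ts) 0 ↥(Matrix.specialUnitaryGroup (Fin 2) ℂ))
    (J : GaugeField (F.P j) 0 ↥(Matrix.specialUnitaryGroup (Fin 2) ℂ) × Z → NNReal)
    (rc κ M : ℝ) (hθ : 0 < θBal F.L γ b₀ p₀ j)
    (Prof : GaugeField (F.P j) 0 ↥(Matrix.specialUnitaryGroup (Fin 2) ℂ) → (Z → ℝ) → (ι → ℝ) → Prop)
    (𝒢 : ι → ι → ℝ) (ωf : ι → ι → ℝ) (NG : ℝ) (hG0 : ∀ a c, 0 ≤ 𝒢 a c) (hωf : ∀ a c, 0 ≤ ωf a c) (hNG : 0 ≤ NG)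
    (hGrow : ∀ a, ∑ c, 𝒢 a c * ωf a c ≤ NG) (hGcol : ∀ c, ∑ a, 𝒢 a c * ωf a c ≤ NG) (hωfsymm : ∀ a c, ωf a c = ωf c a)
    (hCov : ∀ t : ℝ, 0 ≤ t → t ≤ 1 → ∀ (B B' : PBond (F.P j) 0) (m m' : Fin 3 → ℝ) (U₁ V₁ W₂ : GaugeField (F.P j) 0 ↥(Matrix.specialUnitaryGroup (Fin 2) ℂ)),
      ‖m‖ ≤ rc * (θBal F.L γ b₀ p₀ j / 4) → ‖m'‖ ≤ rc * (θBal F.L γ b₀ p₀ j / 4) → PlaqSmall (θBal F.L γ b₀ p₀ j / 4) U₁ → PlaqSmall (θBal F.L γ b₀ p₀ j / 4) V₁ →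
      PlaqSmall (θBal F.L γ b₀ p₀ j / 4) W₂ →
      (∀ e, e ≠ B → V₁ e = U₁ e) → V₁ B = U₁ B * expPt m → (∀ e, e ≠ B' → W₂ e = V₁ e) → W₂ B' = V₁ B' * expPt m' →
      ∀ (X : ℝ → GaugeField (F.P j) 0 ↥(Matrix.specialUnitaryGroup (Fin 2) ℂ)), (∀ s e, e ≠ B' → X s e = V₁ e) → (∀ s, X s B' = V₁ B' * expPt (s • m')) →
      ∀ s ∈ Set.Icc (0:ℝ) 1, ∀ (Pf Qf : Z → ℝ) (p q : ι → ℝ), Prof (X s) Pf p → Prof (X s) Qf q → ∀ (cP cQ : ℝ),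
        cP = ∫ z, Pf z * (wNum F γ b₀ p₀ j Ts ρ ρ' Φ J t (X s) z / ∫ z', wNum F γ b₀ p₀ j Ts ρ ρ' Φ J t (X s) z' ∂τ) ∂τ → cQ = ∫ z, Qf z * (wNum F γ b₀ p₀ j Ts ρ ρ' Φ J t (X s) z / ∫ z', wNum F γ b₀ p₀ j Ts ρ ρ' Φ J t (X s) z' ∂τ) ∂τ →
          Integrable (fun z => (Pf z - cP) * (Qf z - cQ) * (wNum F γ b₀ p₀ j Ts ρ ρ' Φ J t (X s) z / ∫ z', wNum F γ b₀ p₀ j Ts ρ ρ' Φ J t (X s) z' ∂τ)) τ ∧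
            |∫ z, (Pf z - cP) * (Qf z - cQ) * (wNum F γ b₀ p₀ j Ts ρ ρ' Φ J t (X s) z / ∫ z', wNum F γ b₀ p₀ j Ts ρ ρ' Φ J t (X s) z' ∂τ) ∂τ| ≤ ∑ a, ∑ c, |p a| * 𝒢 a c * |q c|)
    (K Q₁ : ι → PBond (F.P j) 0 → ℝ) (ωX : ι → PBond (F.P j) 0 → ℝ) (Ncol Nrow : ℝ) (hK0 : ∀ a B, 0 ≤ K a B) (hQ0 : ∀ a B, 0 ≤ Q₁ a B) (hωX : ∀ a B, 0 ≤ ωX a B)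
    (hNcol : 0 ≤ Ncol) (hNrow : 0 ≤ Nrow)
    (hKcol : ∀ B, ∑ a, K a B * ωX a B ≤ Ncol) (hKrow : ∀ c, ∑ B', K c B' * ωX c B' ≤ Ncol)
    (hQrow : ∀ c, ∑ B', Q₁ c B' * ωX c B' ≤ Nrow) (hQcol : ∀ B, ∑ a, Q₁ a B * ωX a B ≤ Nrow)
    (htri : ∀ (B B' : PBond (F.P j) 0) (a c : ι), Real.exp (κ * (B.src.tdist B'.src : ℝ)) ≤ ωX a B * ωf a c * ωX c B')
    (htdsymm : ∀ B B' : PBond (F.P j) 0, (B.src.tdist B'.src : ℝ) = (B'.src.tdist B.src : ℝ))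
    (hProfF : ∀ t : ℝ, 0 ≤ t → t ≤ 1 → ∀ (B B' : PBond (F.P j) 0) (m m' : Fin 3 → ℝ) (U₁ V₁ W₂ : GaugeField (F.P j) 0 ↥(Matrix.specialUnitaryGroup (Fin 2) ℂ)),
      ‖m‖ ≤ rc * (θBal F.L γ b₀ p₀ j / 4) → ‖m'‖ ≤ rc * (θBal F.L γ b₀ p₀ j / 4) → PlaqSmall (θBal F.L γ b₀ p₀ j / 4) U₁ → PlaqSmall (θBal F.L γ b₀ p₀ j / 4) V₁ →
      PlaqSmall (θBal F.L γ b₀ p₀ j / 4) W₂ →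
      (∀ e, e ≠ B → V₁ e = U₁ e) → V₁ B = U₁ B * expPt m → (∀ e, e ≠ B' → W₂ e = V₁ e) → W₂ B' = V₁ B' * expPt m' →
      ∀ (X : ℝ → GaugeField (F.P j) 0 ↥(Matrix.specialUnitaryGroup (Fin 2) ℂ)), (∀ s e, e ≠ B' → X s e = V₁ e) → (∀ s, X s B' = V₁ B' * expPt (s • m')) →
      ∀ s ∈ Set.Icc (0:ℝ) 1,
        Prof (X s) (fun z => (Real.log (ρ Ts (Φ (V₁, z))) - Real.log (ρ' Ts (Φ (V₁, z)))) - (Real.log (ρ Ts (Φ (U₁, z))) - Real.log (ρ' Ts (Φ (U₁, z)))))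
            (fun a => ‖m‖ / (θBal F.L γ b₀ p₀ j / 4) * K a B) ∧
          Prof (X s) (fun z => deriv (fun s => wNum F γ b₀ p₀ j Ts ρ ρ' Φ J t (X s) z) s / wNum F γ b₀ p₀ j Ts ρ ρ' Φ J t (X s) z) (fun a => ‖m'‖ / (θBal F.L γ b₀ p₀ j / 4) * Q₁ a B'))
    (hlaw : ∀ t : ℝ, 0 ≤ t → t ≤ 1 → ∀ (B B' : PBond (F.P j) 0) (m m' : Fin 3 → ℝ) (U₁ V₁ W₂ : GaugeField (F.P j) 0 ↥(Matrix.specialUnitaryGroup (Fin 2) ℂ)),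
      ‖m‖ ≤ rc * (θBal F.L γ b₀ p₀ j / 4) → ‖m'‖ ≤ rc * (θBal F.L γ b₀ p₀ j / 4) → PlaqSmall (θBal F.L γ b₀ p₀ j / 4) U₁ → PlaqSmall (θBal F.L γ b₀ p₀ j / 4) V₁ →
      PlaqSmall (θBal F.L γ b₀ p₀ j / 4) W₂ →
      (∀ e, e ≠ B → V₁ e = U₁ e) → V₁ B = U₁ B * expPt m → (∀ e, e ≠ B' → W₂ e = V₁ e) → W₂ B' = V₁ B' * expPt m' →
      ∀ (X : ℝ → GaugeField (F.P j) 0 ↥(Matrix.specialUnitaryGroup (Fin 2) ℂ)), (∀ s e, e ≠ B' → X s e = V₁ e) → (∀ s, X s B' = V₁ B' * expPt (s • m')) →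
      ∀ᵐ s ∂(volume : Measure ℝ), s ∈ Set.Icc (0:ℝ) 1 →
        Integrable (fun z => wNum F γ b₀ p₀ j Ts ρ ρ' Φ J t (X s) z / ∫ z', wNum F γ b₀ p₀ j Ts ρ ρ' Φ J t (X s) z' ∂τ) τ ∧ ∫ z, wNum F γ b₀ p₀ j Ts ρ ρ' Φ J t (X s) z / ∫ z', wNum F γ b₀ p₀ j Ts ρ ρ' Φ J t (X s) z' ∂τ ∂τ = 1 ∧
        Integrable (fun z => ((Real.log (ρ Ts (Φ (V₁, z))) - Real.log (ρ' Ts (Φ (V₁, z)))) - (Real.log (ρ Ts (Φ (U₁, z))) - Real.log (ρ' Ts (Φ (U₁, z))))) * (wNum F γ b₀ p₀ j Ts ρ ρ' Φ J t (X s) z / ∫ z', wNum F γ b₀ p₀ j Ts ρ ρ' Φ J t (X s) z' ∂τ)) τ ∧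
        Integrable (fun z => (deriv (fun s => wNum F γ b₀ p₀ j Ts ρ ρ' Φ J t (X s) z) s / wNum F γ b₀ p₀ j Ts ρ ρ' Φ J t (X s) z) * (wNum F γ b₀ p₀ j Ts ρ ρ' Φ J t (X s) z / ∫ z', wNum F γ b₀ p₀ j Ts ρ ρ' Φ J t (X s) z' ∂τ)) τ ∧
        Integrable (fun z => ((Real.log (ρ Ts (Φ (V₁, z))) - Real.log (ρ' Ts (Φ (V₁, z)))) - (Real.log (ρ Ts (Φ (U₁, z))) - Real.log (ρ' Ts (Φ (U₁, z))))) * (deriv (fun s => wNum F γ b₀ p₀ j Ts ρ ρ' Φ J t (X s) z) s / wNum F γ b₀ p₀ j Ts ρ ρ' Φ J t (X s) z) * (wNum F γ b₀ p₀ j Ts ρ ρ' Φ J t (X s) z / ∫ z', wNum F γ b₀ p₀ j Ts ρ ρ' Φ J t (X s) z' ∂τ)) τ)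
    (hM : Ncol * NG * Nrow ≤ M) :
    ∃ kX : PBond (F.P j) 0 → PBond (F.P j) 0 → ℝ, (∀ B B', 0 ≤ kX B B') ∧
      (∀ B, ∑ B', kX B B' * Real.exp (κ * (B.src.tdist B'.src : ℝ)) ≤ M) ∧
      (∀ B', ∑ B, kX B B' * Real.exp (κ * (B.src.tdist B'.src : ℝ)) ≤ M) ∧
      ∀ t : ℝ, 0 ≤ t → t ≤ 1 → ∀ (B B' : PBond (F.P j) 0) (m m' : Fin 3 → ℝ) (U₁ V₁ W₂ : GaugeField (F.P j) 0 ↥(Matrix.specialUnitaryGroup (Fin 2) ℂ)), ‖m‖ ≤ rc * (θBal F.L γ b₀ p₀ j / 4) → ‖m'‖ ≤ rc * (θBal F.L γ b₀ p₀ j / 4) → PlaqSmall (θBal F.L γ b₀ p₀ j / 4) U₁ → PlaqSmall (θBal F.L γ b₀ p₀ j / 4) V₁ → PlaqSmall (θBal F.L γ b₀ p₀ j / 4) W₂ → (∀ e, e ≠ B → V₁ e = U₁ e) → V₁ B = U₁ B * expPt m → (∀ e, e ≠ B' → W₂ e = V₁ e) → W₂ B' = V₁ B' * expPt m' → ∀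 (X : ℝ → GaugeField (F.P j) 0 ↥(Matrix.specialUnitaryGroup (Fin 2) ℂ)), (∀ s e, e ≠ B' → X s e = V₁ e) → (∀ s, X s B' = V₁ B' * expPt (s • m')) →
        (∀ᵐ s ∂(volume : Measure ℝ), s ∈ Set.Icc (0:ℝ) 1 → |(∫ z, ((Real.log (ρ Ts (Φ (V₁, z))) - Real.log (ρ' Ts (Φ (V₁, z)))) - (Real.log (ρ Ts (Φ (U₁, z))) - Real.log (ρ' Ts (Φ (U₁, z))))) * (deriv (fun s => wNum F γ b₀ p₀ j Ts ρ ρ' Φ J t (X s) z) s / wNum F γ b₀ p₀ j Ts ρ ρ' Φ J t (X s) z) * (wNum F γ b₀ p₀ j Ts ρ ρ' Φ J t (X s) z / ∫ z', wNum F γ b₀ p₀ j Ts ρ ρ' Φ J t (X s) z' ∂τ) ∂τ)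
                - (∫ z, ((Real.log (ρ Ts (Φ (V₁, z))) - Real.log (ρ' Ts (Φ (V₁, z)))) - (Real.log (ρ Ts (Φ (U₁, z))) - Real.log (ρ' Ts (Φ (U₁, z))))) * (wNum F γ b₀ p₀ j Ts ρ ρ' Φ J t (X s) z / ∫ z', wNum F γ b₀ p₀ j Ts ρ ρ' Φ J t (X s) z' ∂τ) ∂τ) * (∫ z, (deriv (fun s => wNum F γ b₀ p₀ j Ts ρ ρ' Φ J t (X s) z) s / wNum F γ b₀ p₀ j Ts ρ ρ' Φ J t (X s) z) * (wNum F γ b₀ p₀ j Ts ρ ρ' Φ J t (X s) z / ∫ z', wNum F γ b₀ p₀ j Ts ρ ρ' Φ J t (X s) z' ∂τ) ∂τ)| ≤ kX B B' * (‖m‖ / (θBal F.L γ b₀ p₀ j / 4)) * (‖m'‖ / (θBal F.L γ b₀ p₀ j / 4))) := by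
  exact kerXClause_of_covKernel_profiles τ
    (fun V z => Real.log (ρ Ts (Φ (V, z))) - Real.log (ρ' Ts (Φ (V, z))))
    (fun t Xw z => wNum F γ b₀ p₀ j Ts ρ ρ' Φ J t Xw z / ∫ z', wNum F γ b₀ p₀ j Ts ρ ρ' Φ J t Xw z' ∂τ)
    (fun t X s z => deriv (fun s => wNum F γ b₀ p₀ j Ts ρ ρ' Φ J t (X s) z) s / wNum F γ b₀ p₀ j Ts ρ ρ' Φ J t (X s) z)
    (θBal F.L γ b₀ p₀ j / 4) rc κ M (by positivity) Prof 𝒢 ωf NG hG0 hωf hNG hGrow hGcol hωfsymm hCov K Q₁ ωX Ncol Nrow hK0 hQ0 hωX hNcol hNrow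
    hKcol hKrow hQrow hQcol htri htdsymm hProfF hlaw hM

end Organ

end Summit.QuantumFields.YangMills.Theorems.OrganTangentILawKerXOfScoreProfile

end
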